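import Summits.NavierStokesRegularity.NavierStokesRegularity.Theorems.AdaptedFrequencyAdaptedKernelExistsHypoellipticFields
import Literature.Analysis.Distribution.FieldIntegrationByParts
import Literature.Analysis.Distribution.SmoothCutoff

/-!
# Crux `AdaptedKernelExists` (stmt-NavierStokesRegularity-2956), line `nash-entropy-last-block`:
  STUB `stub_hypoelliptic` — hypoelliptic smoothing of very weak solutions of the backward
  drift–heat equation (Hörmander 1967, Thm 1.1)

Lands `--supports stmt-NavierStokesRegularity-2956` the registered stub `stub_hypoelliptic`: for
`ν > 0`, a drift `b` jointly smooth on `[ta, T) × ℝ³` with `div b = 0`, and `w` locally integrable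
on the open slab `(ta, T) × ℝ³` satisfying the VERY WEAK form of `∂ₜw + b·∇w + νΔw = 0`
(`∫ w (∂ₜφ + b·∇φ − νΔφ) = 0` for all smooth `φ` compactly supported in the slab), there is `g`
jointly smooth on the slab with `w = g` a.e. there and `∂ₜg + b·∇g + νΔg = 0` classically.

Proof (pattern of `Literature/Analysis/Distribution/HeatHypoelliptic.lean`):
* `hypoelliptic_exists_window`: every interior time has a window `U ∋ t` with a cut-off `η`;
* `hypoelliptic_isBracketGenerating`: the window fields `Xⱼ = √ν (0, eⱼ)`, `X₀ = (1, ηb)` of the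
  companion file `…HypoellipticFields` span `ℝ × ℝ³` at every point;
* `hypoelliptic_integral_mul_hormanderTranspose`: the very weak equation reads `∫ w ᵗPφ = 0` for
  `φ` supported in the window (`hypoelliptic_hormanderTranspose_eq`);
* `hypoelliptic_isSmoothOn`: hence the image of the distribution `w dx` under `P` vanishes on
  the window, Hörmander's theorem (`hormander1967_thm11_proof`) makes `w dx` smooth there, and
  smoothness is local (`IsSmoothOn.of_locally`): `w dx = G dx` on the slab with `G` smooth;
  `w = G` a.e. by the fundamental lemma of the calculus of variations;
* `hypoelliptic_classical`: a smooth very weak solution is classical — with a cut-off `χ = 1`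
  near `tsupport φ`, `∫ (P G) φ = ∫ (χG) ᵗPφ = ∫ w ᵗPφ = 0` (`integral_hormanderOp_mul`,
  locality of `P`), so the continuous `P G = ∂ₜG + b·∇G + νΔG` vanishes
  (`eqOn_of_forall_integral_mul_eq`, `hypoelliptic_hormanderOp_apply`).
-/

noncomputable section

open MeasureTheory Set Filter Topology Metric Function Distributions
open scoped ContDiff Laplacian
open Literature.Analysis.FluidPDE Literature.Analysis.Distribution

namespace Summit.NavierStokesRegularity.NavierStokesRegularity.Theorems.AdaptedKernelExists.NashEntropyLastBlock

section Generic

variable {V : Type*} [NormedAddCommGroup V] [InnerProductSpace ℝ V] [FiniteDimensional ℝ V]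
  {ι : Type*} [Fintype ι]

/-! ### The bracket condition, locality and smoothness of `P G` -/

omit [FiniteDimensional ℝ V] in
/-- **The bracket condition at step zero.** The values `X₀(p) = (1, …)` and `Xⱼ(p) = √ν (0, eⱼ)`
already span `ℝ × V` at every point. -/
theorem hypoelliptic_isBracketGenerating {ν : ℝ} (hν : 0 < ν) {η : ℝ → ℝ} {b : ℝ → V → V}
    (e : OrthonormalBasis ι ℝ V) {X₀ : ℝ × V → ℝ × V}
    (hX₀ : X₀ = fun p => ((1 : ℝ), η p.1 • b p.1 p.2)) {X : ι → ℝ × V → ℝ × V}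
    (hX : X = fun j _ => Real.sqrt ν • (((0 : ℝ), e j) : ℝ × V)) (s : Set (ℝ × V)) :
    IsBracketGenerating (fun o : Option ι => o.elim X₀ X) s := by
  intro p _
  set S : Set (ℝ × V) := {v : ℝ × V | ∃ Y : ℝ × V → ℝ × V,
    IsIteratedLieBracket (fun o : Option ι => o.elim X₀ X) Y ∧ Y p = v} with hS
  have h0 : X₀ p ∈ S :=
    ⟨_, IsIteratedLieBracket.of (X := fun o : Option ι => o.elim X₀ X) none, rfl⟩
  have hj : ∀ j, X j p ∈ S := fun j =>
    ⟨_, IsIteratedLieBracket.of (X := fun o : Option ι => o.elim X₀ X) (some j), rfl⟩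
  have hej : ∀ j, (((0 : ℝ), e j) : ℝ × V) ∈ Submodule.span ℝ S := by
    intro j
    have h1 : (((0 : ℝ), e j) : ℝ × V) = (Real.sqrt ν)⁻¹ • X j p := by
      rw [hX, smul_smul, inv_mul_cancel₀ (Real.sqrt_pos.2 hν).ne', one_smul]
    rw [h1]
    exact Submodule.smul_mem _ _ (Submodule.subset_span (hj j))
  have hinr : ∀ z : V, (((0 : ℝ), z) : ℝ × V) ∈ Submodule.span ℝ S := by
    intro z
    have hz : (((0 : ℝ), z) : ℝ × V) = ∑ j, (inner ℝ (e j) z) • (((0 : ℝ), e j) : ℝ × V) := by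
      refine Prod.ext ?_ ?_
      · rw [Prod.fst_sum]
        simp
      · rw [Prod.snd_sum]
        simp only [Prod.smul_snd]
        exact (e.sum_repr' z).symm
    rw [hz]
    exact Submodule.sum_mem _ fun j _ => Submodule.smul_mem _ _ (hej j)
  rw [eq_top_iff]
  rintro ⟨s', y⟩ -
  have hdec : ((s', y) : ℝ × V) = s' • X₀ p + ((0 : ℝ), y - s' • (X₀ p).2) := by
    rw [hX₀]
    refine Prod.ext ?_ ?_ <;> simp
  rw [hdec]
  exact Submodule.add_mem _ (Submodule.smul_mem _ _ (Submodule.subset_span h0)) (hinr _)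

omit [InnerProductSpace ℝ V] [FiniteDimensional ℝ V] in
/-- Hörmander's operator is local: `P f (z) = P g (z)` if `f = g` near `z`. -/
theorem hypoelliptic_hormanderOp_congr [NormedSpace ℝ V] {X₀ : ℝ × V → ℝ × V}
    {X : ι → ℝ × V → ℝ × V} {c f g : ℝ × V → ℝ} {z : ℝ × V} (h : f =ᶠ[𝓝 z] g) :
    hormanderOp X₀ X c f z = hormanderOp X₀ X c g z := by
  have h1 : ∀ Y : ℝ × V → ℝ × V, fieldDeriv Y f =ᶠ[𝓝 z] fieldDeriv Y g := fun Y => by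
    filter_upwards [h.fderiv (𝕜 := ℝ)] with y hy
    simp only [fieldDeriv_apply, hy]
  have h2 : ∀ Y : ℝ × V → ℝ × V, fieldDeriv Y (fieldDeriv Y f) z = fieldDeriv Y (fieldDeriv Y g) z :=
    fun Y => by simp only [fieldDeriv_apply, (h1 Y).fderiv_eq (𝕜 := ℝ)]
  simp only [hormanderOp, h2, (h1 X₀).eq_of_nhds, h.eq_of_nhds]

omit [InnerProductSpace ℝ V] [FiniteDimensional ℝ V] [Fintype ι] in
/-- `X f` is smooth on an open set where `f` is smooth (`X` smooth). -/
theorem hypoelliptic_contDiffOn_fieldDeriv [NormedSpace ℝ V] {Ω : Set (ℝ × V)} (hΩ : IsOpen Ω)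
    {Y : ℝ × V → ℝ × V} (hY : ContDiff ℝ ∞ Y) {f : ℝ × V → ℝ} (hf : ContDiffOn ℝ ∞ f Ω) :
    ContDiffOn ℝ ∞ (fieldDeriv Y f) Ω :=
  (hf.fderiv_of_isOpen hΩ (by exact_mod_cast le_top)).clm_apply hY.contDiffOn

omit [InnerProductSpace ℝ V] [FiniteDimensional ℝ V] in
/-- `P f` is smooth on an open set where `f` is smooth (smooth coefficients). -/
theorem hypoelliptic_contDiffOn_hormanderOp [NormedSpace ℝ V] {Ω : Set (ℝ × V)} (hΩ : IsOpen Ω)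
    {X₀ : ℝ × V → ℝ × V} {X : ι → ℝ × V → ℝ × V} {c f : ℝ × V → ℝ} (hX₀ : ContDiff ℝ ∞ X₀)
    (hX : ∀ j, ContDiff ℝ ∞ (X j)) (hc : ContDiff ℝ ∞ c) (hf : ContDiffOn ℝ ∞ f Ω) :
    ContDiffOn ℝ ∞ (hormanderOp X₀ X c f) Ω := by
  unfold hormanderOp
  exact ((ContDiffOn.sum fun j _ => hypoelliptic_contDiffOn_fieldDeriv hΩ (hX j)
    (hypoelliptic_contDiffOn_fieldDeriv hΩ (hX j) hf)).add
    (hypoelliptic_contDiffOn_fieldDeriv hΩ hX₀ hf)).add (hc.contDiffOn.mul hf)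

end Generic

/-! ### Windows -/

/-- Every interior time `t₀ ∈ (ta, T)` has a window: an open time interval `U ∋ t₀` inside
`(ta, T)` and a smooth cut-off `η` with `η = 1` on `U` and `tsupport η ⊆ (ta, T)`. -/
theorem hypoelliptic_exists_window {ta T t₀ : ℝ} (ht₀ : t₀ ∈ Ioo ta T) :
    ∃ U : Set ℝ, IsOpen U ∧ t₀ ∈ U ∧ U ⊆ Ioo ta T ∧
      ∃ η : ℝ → ℝ, ContDiff ℝ ∞ η ∧ tsupport η ⊆ Ioo ta T ∧ ∀ s ∈ U, η s = 1 := by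
  obtain ⟨r, hr⟩ : ∃ r : ℝ, r = min (t₀ - ta) (T - t₀) := ⟨_, rfl⟩
  have hr0 : 0 < r := by rw [hr]; exact lt_min (by linarith [ht₀.1]) (by linarith [ht₀.2])
  have hr1 : r ≤ t₀ - ta := by rw [hr]; exact min_le_left _ _
  have hr2 : r ≤ T - t₀ := by rw [hr]; exact min_le_right _ _
  let η : ContDiffBump t₀ := ⟨r / 2, 3 * r / 4, by positivity, by linarith⟩
  refine ⟨ball t₀ (r / 2), isOpen_ball, mem_ball_self (by positivity), ?_, η, η.contDiff, ?_, ?_⟩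
  · intro s hs
    rw [mem_ball, Real.dist_eq] at hs
    obtain ⟨h1, h2⟩ := abs_lt.1 hs
    exact ⟨by linarith, by linarith⟩
  · rw [η.tsupport_eq]
    intro s hs
    rw [mem_closedBall, Real.dist_eq] at hs
    change |s - t₀| ≤ 3 * r / 4 at hs
    obtain ⟨h1, h2⟩ := abs_le.1 hs
    exact ⟨by linarith, by linarith⟩
  · intro s hs
    exact η.one_of_mem_closedBall (ball_subset_closedBall hs)

/-! ### The very weak equation tested against `ᵗP φ` (space `ℝ³` from here on) -/

/-- On a window, the very weak backward drift–heat equation says `∫ w · ᵗPφ = 0` for every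
smooth `φ` compactly supported in `U × ℝ³`. -/
theorem hypoelliptic_integral_mul_hormanderTranspose {ν ta T : ℝ}
    {b : ℝ → EuclideanSpace ℝ (Fin 3) → EuclideanSpace ℝ (Fin 3)}
    {w : ℝ × EuclideanSpace ℝ (Fin 3) → ℝ} (hν : 0 < ν) (hb : IsSmoothSpaceTimeOn (Ico ta T) b)
    (hdiv : ∀ t ∈ Ico ta T, VectorCalculus.IsDivFree (b t))
    (hweak : ∀ φ : ℝ × EuclideanSpace ℝ (Fin 3) → ℝ, ContDiff ℝ ∞ φ → HasCompactSupport φ →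
      tsupport φ ⊆ Ioo ta T ×ˢ univ →
      ∫ p, w p * (deriv (fun s => φ (s, p.2)) p.1 +
          fderiv ℝ (fun y => φ (p.1, y)) p.2 (b p.1 p.2) -
          ν * (Δ (fun y => φ (p.1, y))) p.2) = 0)
    {η : ℝ → ℝ} {U : Set ℝ} (hU : IsOpen U) (hUs : U ⊆ Ioo ta T) (hηU : ∀ s ∈ U, η s = 1)
    (e : OrthonormalBasis (Fin 3) ℝ (EuclideanSpace ℝ (Fin 3)))
    {X₀ : ℝ × EuclideanSpace ℝ (Fin 3) → ℝ × EuclideanSpace ℝ (Fin 3)}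
    (hX₀ : X₀ = fun p => ((1 : ℝ), η p.1 • b p.1 p.2))
    {X : Fin 3 → ℝ × EuclideanSpace ℝ (Fin 3) → ℝ × EuclideanSpace ℝ (Fin 3)}
    (hX : X = fun j _ => Real.sqrt ν • (((0 : ℝ), e j) : ℝ × EuclideanSpace ℝ (Fin 3)))
    {φ : ℝ × EuclideanSpace ℝ (Fin 3) → ℝ} (hφ : ContDiff ℝ ∞ φ) (hφc : HasCompactSupport φ)
    (hφU : tsupport φ ⊆ Prod.fst ⁻¹' U) :
    ∫ p, w p * hormanderTranspose X₀ X (fun _ => 0) φ p = 0 := by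
  have h := hweak φ hφ hφc (hφU.trans fun p hp => ⟨hUs hp, mem_univ _⟩)
  have e1 : (fun p => w p * hormanderTranspose X₀ X (fun _ => 0) φ p) = fun p =>
      -(w p * (deriv (fun s => φ (s, p.2)) p.1 +
          fderiv ℝ (fun y => φ (p.1, y)) p.2 (b p.1 p.2) -
          ν * (Δ (fun y => φ (p.1, y))) p.2)) := by
    funext p
    rw [hypoelliptic_hormanderTranspose_eq hν hb hdiv hU hUs hηU e hX₀ hX hφ hφU p]
    ring
  rw [e1, integral_neg, h, neg_zero]

/-! ### Hypoelliptic smoothing of the distribution `w dx` -/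

/-- **The distribution `w dx` is smooth on the slab.** Near every point of the open slab
`(ta, T) × ℝ³` choose a window; the Hörmander fields of the window are smooth, span, and the
very weak equation says that the image of `w dx` under `P = Σⱼ Xⱼ² + X₀` vanishes on the
window, so Hörmander's theorem (`hormander1967_thm11_proof`) makes `w dx` smooth there;
smoothness of a distribution is a local property (`IsSmoothOn.of_locally`). -/
theorem hypoelliptic_isSmoothOn {ν ta T : ℝ}
    {b : ℝ → EuclideanSpace ℝ (Fin 3) → EuclideanSpace ℝ (Fin 3)}
    {w : ℝ × EuclideanSpace ℝ (Fin 3) → ℝ} (hν : 0 < ν) (hb : IsSmoothSpaceTimeOn (Ico ta T) b)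
    (hdiv : ∀ t ∈ Ico ta T, VectorCalculus.IsDivFree (b t))
    (hweak : ∀ φ : ℝ × EuclideanSpace ℝ (Fin 3) → ℝ, ContDiff ℝ ∞ φ → HasCompactSupport φ →
      tsupport φ ⊆ Ioo ta T ×ˢ univ →
      ∫ p, w p * (deriv (fun s => φ (s, p.2)) p.1 +
          fderiv ℝ (fun y => φ (p.1, y)) p.2 (b p.1 p.2) -
          ν * (Δ (fun y => φ (p.1, y))) p.2) = 0)
    (Ω : TopologicalSpace.Opens (ℝ × EuclideanSpace ℝ (Fin 3)))
    (hΩ : (Ω : Set (ℝ × EuclideanSpace ℝ (Fin 3))) = Ioo ta T ×ˢ univ) (u : 𝓓'(Ω, ℝ))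
    (hu : ∀ φ : 𝓓(Ω, ℝ), u φ = ∫ x, φ x * w x) :
    IsSmoothOn u volume (Ioo ta T ×ˢ univ) := by
  haveI : (volume : Measure (ℝ × EuclideanSpace ℝ (Fin 3))).IsAddHaarMeasure := by
    rw [show (volume : Measure (ℝ × EuclideanSpace ℝ (Fin 3))) =
      (volume : Measure ℝ).prod (volume : Measure (EuclideanSpace ℝ (Fin 3))) from rfl]
    infer_instance
  set e := EuclideanSpace.basisFun (Fin 3) ℝ
  refine IsSmoothOn.of_locally hΩ.symm.subset fun p hp => ?_
  obtain ⟨U, hU, hpU, hUs, η, hη, hηs, hηU⟩ := hypoelliptic_exists_window (T := T) hp.1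
  obtain ⟨X₀, hX₀⟩ : ∃ X₀ : ℝ × EuclideanSpace ℝ (Fin 3) → ℝ × EuclideanSpace ℝ (Fin 3),
      X₀ = fun q => ((1 : ℝ), η q.1 • b q.1 q.2) := ⟨_, rfl⟩
  obtain ⟨X, hX⟩ : ∃ X : Fin 3 → ℝ × EuclideanSpace ℝ (Fin 3) → ℝ × EuclideanSpace ℝ (Fin 3),
      X = fun j _ => Real.sqrt ν • (((0 : ℝ), e j) : ℝ × EuclideanSpace ℝ (Fin 3)) := ⟨_, rfl⟩
  have hX₀s : ContDiff ℝ ∞ X₀ := hypoelliptic_contDiff_driftField hb hη hηs hX₀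
  have hXs : ∀ j, ContDiff ℝ ∞ (X j) := hypoelliptic_contDiff_squareField e hX
  have hVo : IsOpen (Prod.fst ⁻¹' U : Set (ℝ × EuclideanSpace ℝ (Fin 3))) :=
    hU.preimage continuous_fst
  have hVΩ : (Prod.fst ⁻¹' U : Set (ℝ × EuclideanSpace ℝ (Fin 3))) ⊆ Ioo ta T ×ˢ univ :=
    fun q hq => ⟨hUs hq, mem_univ _⟩
  refine ⟨Prod.fst ⁻¹' U, hVo, hpU, hVΩ, ?_⟩
  have hhyp : IsHypoellipticOn Ω (hormanderTranspose X₀ X fun _ => 0) volume :=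
    Literature.Analysis.Hypoelliptic.hormander1967_thm11_proof (ℝ × EuclideanSpace ℝ (Fin 3))
      volume (Fin 3) Ω X₀ X (fun _ => 0) hX₀s hXs contDiff_const
      (hypoelliptic_isBracketGenerating hν e hX₀ hX _)
  refine hhyp u _ hVo (hVΩ.trans hΩ.symm.subset) ⟨0, contDiffOn_const, fun φ ψ hφV hψ => ?_⟩
  rw [hu ψ]
  simp only [Pi.zero_apply, zero_mul, integral_zero]
  calc ∫ x, ψ x * w x = ∫ x, w x * hormanderTranspose X₀ X (fun _ => 0) φ x :=
        integral_congr_ae (Eventually.of_forall fun x => by dsimp only; rw [hψ, mul_comm])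
    _ = 0 := hypoelliptic_integral_mul_hormanderTranspose hν hb hdiv hweak hU hUs hηU e hX₀ hX
        φ.contDiff φ.hasCompactSupport hφV

/-! ### A smooth very weak solution is a classical solution -/

/-- **Smooth + very weak ⇒ classical.** If `G` is smooth on the slab and agrees a.e. there
with the very weak solution `w`, then `∂ₜG + b·∇G + νΔG = 0` at every point of the slab: on a
window, `∫ (P G) φ = ∫ (χG) ᵗPφ = ∫ w ᵗPφ = 0` for every test `φ` (cut-off `χ = 1` near
`tsupport φ`, `integral_hormanderOp_mul`, locality of `P`), so the continuous function `P G`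
vanishes on the window (`eqOn_of_forall_integral_mul_eq`), and `P G = ∂ₜG + b·∇G + νΔG` there. -/
theorem hypoelliptic_classical {ν ta T : ℝ}
    {b : ℝ → EuclideanSpace ℝ (Fin 3) → EuclideanSpace ℝ (Fin 3)}
    {w : ℝ × EuclideanSpace ℝ (Fin 3) → ℝ} (hν : 0 < ν) (hb : IsSmoothSpaceTimeOn (Ico ta T) b)
    (hdiv : ∀ t ∈ Ico ta T, VectorCalculus.IsDivFree (b t))
    (hweak : ∀ φ : ℝ × EuclideanSpace ℝ (Fin 3) → ℝ, ContDiff ℝ ∞ φ → HasCompactSupport φ →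
      tsupport φ ⊆ Ioo ta T ×ˢ univ →
      ∫ p, w p * (deriv (fun s => φ (s, p.2)) p.1 +
          fderiv ℝ (fun y => φ (p.1, y)) p.2 (b p.1 p.2) -
          ν * (Δ (fun y => φ (p.1, y))) p.2) = 0)
    {G : ℝ × EuclideanSpace ℝ (Fin 3) → ℝ} (hG : ContDiffOn ℝ ∞ G (Ioo ta T ×ˢ univ))
    (hae : ∀ᵐ p : ℝ × EuclideanSpace ℝ (Fin 3), p ∈ Ioo ta T ×ˢ univ → w p = G p) {t : ℝ}
    (ht : t ∈ Ioo ta T) (x : EuclideanSpace ℝ (Fin 3)) :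
    deriv (fun s => G (s, x)) t + fderiv ℝ (fun y => G (t, y)) x (b t x) +
      ν * (Δ fun y => G (t, y)) x = 0 := by
  haveI : (volume : Measure (ℝ × EuclideanSpace ℝ (Fin 3))).IsAddHaarMeasure := by
    rw [show (volume : Measure (ℝ × EuclideanSpace ℝ (Fin 3))) =
      (volume : Measure ℝ).prod (volume : Measure (EuclideanSpace ℝ (Fin 3))) from rfl]
    infer_instance
  set e := EuclideanSpace.basisFun (Fin 3) ℝ
  have hΩ₀ : IsOpen (Ioo ta T ×ˢ (univ : Set (EuclideanSpace ℝ (Fin 3)))) :=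
    isOpen_Ioo.prod isOpen_univ
  obtain ⟨U, hU, htU, hUs, η, hη, hηs, hηU⟩ := hypoelliptic_exists_window ht
  obtain ⟨X₀, hX₀⟩ : ∃ X₀ : ℝ × EuclideanSpace ℝ (Fin 3) → ℝ × EuclideanSpace ℝ (Fin 3),
      X₀ = fun q => ((1 : ℝ), η q.1 • b q.1 q.2) := ⟨_, rfl⟩
  obtain ⟨X, hX⟩ : ∃ X : Fin 3 → ℝ × EuclideanSpace ℝ (Fin 3) → ℝ × EuclideanSpace ℝ (Fin 3),
      X = fun j _ => Real.sqrt ν • (((0 : ℝ), e j) : ℝ × EuclideanSpace ℝ (Fin 3)) := ⟨_, rfl⟩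
  have hX₀s : ContDiff ℝ ∞ X₀ := hypoelliptic_contDiff_driftField hb hη hηs hX₀
  have hXs : ∀ j, ContDiff ℝ ∞ (X j) := hypoelliptic_contDiff_squareField e hX
  have hVo : IsOpen (Prod.fst ⁻¹' U : Set (ℝ × EuclideanSpace ℝ (Fin 3))) :=
    hU.preimage continuous_fst
  have hVΩ : (Prod.fst ⁻¹' U : Set (ℝ × EuclideanSpace ℝ (Fin 3))) ⊆ Ioo ta T ×ˢ univ :=
    fun q hq => ⟨hUs hq, mem_univ _⟩
  have hPG : ContinuousOn (hormanderOp X₀ X (fun _ => 0) G) (Prod.fst ⁻¹' U) :=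
    ((hypoelliptic_contDiffOn_hormanderOp hΩ₀ hX₀s hXs contDiff_const hG).mono hVΩ).continuousOn
  have key : EqOn (hormanderOp X₀ X (fun _ => 0) G) (fun _ => 0)
      ((Prod.fst ⁻¹' U) ∩ (Prod.fst ⁻¹' U)) := by
    refine eqOn_of_forall_integral_mul_eq (μ := volume) hVo hVo hPG continuousOn_const
      fun φ hφ hφc hφV => ?_
    rw [inter_self] at hφV
    have hKΩ : tsupport φ ⊆ Ioo ta T ×ˢ univ := hφV.trans hVΩ
    -- a cut-off `χ = 1` near `tsupport φ`, supported in the slab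
    obtain ⟨δ, hδ, hδΩ⟩ := hφc.exists_thickening_subset_open hΩ₀ hKΩ
    obtain ⟨χ, hχs, -, -, hχ1, hχsupp, -⟩ :=
      exists_smooth_cutoff (tsupport φ) (δ := δ / 3) (by positivity)
    have hχΩ : tsupport χ ⊆ Ioo ta T ×ˢ univ :=
      hχsupp.trans (by rw [show 3 * (δ / 3) = δ by ring]; exact hδΩ)
    have hχc : HasCompactSupport χ :=
      IsCompact.of_isClosed_subset hφc.cthickening (isClosed_tsupport χ)
        (hχsupp.trans (thickening_subset_cthickening _ _))
    obtain ⟨f, hf⟩ : ∃ f : ℝ × EuclideanSpace ℝ (Fin 3) → ℝ, f = fun z => χ z * G z := ⟨_, rfl⟩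
    have hfs : ContDiff ℝ ∞ f := by
      rw [hf]; exact contDiff_mul_of_tsupport_subset hΩ₀ hχs hχΩ hG
    have hfc : HasCompactSupport f := by rw [hf]; exact hχc.mul_right
    have hfG : ∀ z ∈ tsupport φ, f =ᶠ[𝓝 z] G := fun z hz => by
      filter_upwards [isOpen_thickening.mem_nhds
        (self_subset_thickening (δ := δ / 3) (by positivity) _ hz)] with y hy
      rw [hf]
      show χ y * G y = G y
      rw [hχ1 y hy, one_mul]
    have hPf := integral_hormanderOp_mul (μ := volume) hX₀s hXs contDiff_const hfs hφ hfc
      (X₀ := X₀) (X := X) (c := fun _ => 0)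
    -- `∫ (P G) φ = ∫ (P f) φ`
    have e1 : ∫ z, hormanderOp X₀ X (fun _ => 0) G z * φ z =
        ∫ z, hormanderOp X₀ X (fun _ => 0) f z * φ z := by
      refine integral_congr_ae (Eventually.of_forall fun z => ?_)
      by_cases hz : z ∈ tsupport φ
      · simp only [hypoelliptic_hormanderOp_congr (hfG z hz)]
      · simp only [image_eq_zero_of_notMem_tsupport hz, mul_zero]
    -- `∫ f ᵗPφ = ∫ w ᵗPφ (= 0)`
    have e2 : ∫ z, f z * hormanderTranspose X₀ X (fun _ => 0) φ z =
        ∫ z, w z * hormanderTranspose X₀ X (fun _ => 0) φ z := by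
      refine integral_congr_ae ?_
      filter_upwards [hae] with z hz
      by_cases hzt : z ∈ tsupport (hormanderTranspose X₀ X (fun _ => 0) φ)
      · have hzK : z ∈ tsupport φ := tsupport_hormanderTranspose_subset X₀ X _ φ hzt
        rw [hz (hKΩ hzK), hf]
        show χ z * G z * _ = _
        rw [hχ1 z (self_subset_thickening (δ := δ / 3) (by positivity) _ hzK), one_mul]
      · simp only [image_eq_zero_of_notMem_tsupport hzt, mul_zero]
    rw [e1, hPf, e2, hypoelliptic_integral_mul_hormanderTranspose hν hb hdiv hweak hU hUs hηU e
      hX₀ hX hφ hφc hφV]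
    simp
  have := key (show ((t, x) : ℝ × EuclideanSpace ℝ (Fin 3)) ∈ Prod.fst ⁻¹' U ∩ Prod.fst ⁻¹' U
    from ⟨htU, htU⟩)
  rw [hypoelliptic_hormanderOp_apply hν hUs hηU e hX₀ hX hG htU x] at this
  exact this

/-! ### The stub -/

/-- **STUB `stub_hypoelliptic` — hypoelliptic smoothing (Hörmander 1967, Thm 1.1).** Let
`ν > 0`, `b` jointly smooth on `[ta, T) × ℝ³` and divergence free, and let `w` be locally
integrable on the open slab `(ta, T) × ℝ³` and a very weak solution of `∂ₜw + b·∇w + νΔw = 0`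
there. Then `w` agrees a.e. on the slab with a function `g`, jointly smooth on `(ta, T) × ℝ³`,
which solves the equation classically at every point of the slab. Proof: the distribution
`w dx` on the slab is smooth (`hypoelliptic_isSmoothOn`: windows, the Hörmander fields
`Xⱼ = √ν (0, eⱼ)`, `X₀ = (1, ηb)`, `hormander1967_thm11_proof`, locality), i.e. given by a smooth
density `G`; `w = G` a.e. by the fundamental lemma of the calculus of variations; and a smooth
very weak solution is classical (`hypoelliptic_classical`). -/
theorem stub_hypoelliptic :
    ∀ (ν ta T : ℝ) (b : ℝ → EuclideanSpace ℝ (Fin 3) → EuclideanSpace ℝ (Fin 3))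
      (w : ℝ × EuclideanSpace ℝ (Fin 3) → ℝ),
      0 < ν → ta < T →
      IsSmoothSpaceTimeOn (Ico ta T) b →
      (∀ t ∈ Ico ta T, VectorCalculus.IsDivFree (b t)) →
      LocallyIntegrableOn w (Ioo ta T ×ˢ univ) volume →
      (∀ φ : ℝ × EuclideanSpace ℝ (Fin 3) → ℝ, ContDiff ℝ ∞ φ → HasCompactSupport φ →
        tsupport φ ⊆ Ioo ta T ×ˢ univ →
        ∫ p, w p * (deriv (fun s => φ (s, p.2)) p.1 +
            fderiv ℝ (fun y => φ (p.1, y)) p.2 (b p.1 p.2) -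
            ν * (Δ (fun y => φ (p.1, y))) p.2) = 0) →
      ∃ g : ℝ → EuclideanSpace ℝ (Fin 3) → ℝ,
        IsSmoothSpaceTimeOn (Ioo ta T) g ∧
        (∀ᵐ p : ℝ × EuclideanSpace ℝ (Fin 3), p ∈ Ioo ta T ×ˢ univ → w p = g p.1 p.2) ∧
        ∀ t ∈ Ioo ta T, ∀ x,
          deriv (fun s => g s x) t + fderiv ℝ (g t) x (b t x) + ν * (Δ (g t)) x = 0 := by
  intro ν ta T b w hν _ hb hdiv hw hweak
  haveI : (volume : Measure (ℝ × EuclideanSpace ℝ (Fin 3))).IsAddHaarMeasure := by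
    rw [show (volume : Measure (ℝ × EuclideanSpace ℝ (Fin 3))) =
      (volume : Measure ℝ).prod (volume : Measure (EuclideanSpace ℝ (Fin 3))) from rfl]
    infer_instance
  have hΩ₀ : IsOpen (Ioo ta T ×ˢ (univ : Set (EuclideanSpace ℝ (Fin 3)))) :=
    isOpen_Ioo.prod isOpen_univ
  let ΩO : TopologicalSpace.Opens (ℝ × EuclideanSpace ℝ (Fin 3)) := ⟨Ioo ta T ×ˢ univ, hΩ₀⟩
  let uD : 𝓓'(ΩO, ℝ) :=
    (TestFunction.integralAgainstBilinCLM (ContinuousLinearMap.mul ℝ ℝ) volume w :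
      𝓓(ΩO, ℝ) →L[ℝ] ℝ)
  have huD : ∀ φ : 𝓓(ΩO, ℝ), uD φ = ∫ x, φ x * w x := by
    intro φ
    change TestFunction.integralAgainstBilinCLM (ContinuousLinearMap.mul ℝ ℝ) volume w φ = _
    rw [TestFunction.integralAgainstBilinCLM_eq_integral hw]
    simp
  obtain ⟨G, hG, hGu⟩ := hypoelliptic_isSmoothOn hν hb hdiv hweak ΩO rfl uD huD
  -- `w = G` a.e. on the slab (fundamental lemma of the calculus of variations)
  have hGli : LocallyIntegrableOn G (Ioo ta T ×ˢ univ) volume :=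
    hG.continuousOn.locallyIntegrableOn hΩ₀.measurableSet
  have hae : ∀ᵐ p : ℝ × EuclideanSpace ℝ (Fin 3), p ∈ Ioo ta T ×ˢ univ → w p = G p := by
    have hz := hΩ₀.ae_eq_zero_of_integral_contDiff_smul_eq_zero (μ := volume)
      (f := fun x => w x - G x) (hw.sub hGli) (fun φ hφ hφc hφU => by
        let φg : 𝓓(ΩO, ℝ) := ⟨φ, hφ, hφc, hφU⟩
        have h1 : ∫ x, φ x * w x = ∫ x, G x * φ x := by
          have := hGu φg hφU
          rw [huD] at this
          exact this
        have hi1 : Integrable (fun x => φ x * w x) :=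
          TestFunction.integrable_bilin (ContinuousLinearMap.mul ℝ ℝ) hw φg
        have hi2 : Integrable (fun x => φ x * G x) :=
          TestFunction.integrable_bilin (ContinuousLinearMap.mul ℝ ℝ) hGli φg
        simp only [smul_eq_mul, mul_sub]
        rw [integral_sub hi1 hi2, h1, sub_eq_zero]
        exact integral_congr_ae (Eventually.of_forall fun x => mul_comm _ _))
    filter_upwards [hz] with x hx hxU
    exact sub_eq_zero.1 (hx hxU)
  exact ⟨fun t x => G (t, x), hG, hae, fun t ht x =>
    hypoelliptic_classical hν hb hdiv hweak hG hae ht x⟩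

end Summit.NavierStokesRegularity.NavierStokesRegularity.Theorems.AdaptedKernelExists.NashEntropyLastBlock
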